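import Summits.SmoothPoincare4.SmoothPoincare4.Theorems.InformationMetricHadamardConvexEndRecognitionExp
import Literature.Geometry.Riemannian.CutLocusProofs
import HarnessLib

/-!
# Convex bodies in a Hadamard manifold: segments, exit points of rays, reversal of segments
(helper file for route InformationMetricHadamard, item `HadamardConvexBoundarySphere`,
stmt-SmoothPoincare4-6016)

For a Cartan–Hadamard manifold `(M, g)` (simply connected, geodesically complete,
`Rm(X,Y,Y,X) ≤ 0`; `exp_p` is then a diffeomorphism and all geodesic segments minimise — the
sibling helper file `InformationMetricHadamardConvexEndRecognitionExp.lean`, namespace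
`HadamardConvex`, which this file builds on) and a set `C ⊆ M` which is convex in the betweenness
form of the route item (`d(p, m) + d(m, q) = d(p, q)`, `p, q ∈ C` ⇒ `m ∈ C`):

* `expMap_expMap_smul_neg`, `expMap_expMap_neg`, `expMap_neg_of_eq` — reversal of geodesic segments in the form
  `exp_q(s · (−d(exp_p)_v v)) = exp_p((1 − s) v)`, `q = exp_p v` (only completeness is used; the
  differential form of `γ_v'(1)` is the one consumed by the transversality step of the item);
* `exists_exit` — for compact `C` and an interior point `o`, every ray from `o` leaves `C` at a
  frontier point `exp_o(T u)`, `T > 0`, beyond which it does not return to `C`;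
* `expMap_smul_mem_interior_of_mem_frontier` — between `o` and a frontier point of its ray there
  are only interior points (so a ray from `o` meets the frontier exactly once);
* `apply_smul_mem_interior` — the cone over `exp_p⁻¹(interior C)` with apex `0 = exp_p⁻¹ p`,
  `p ∈ C`, is mapped by `exp_p` into `interior C` (form used by the transversality step);
* `exists_eq_smul_of_fderiv_normalize_eq_zero` — the kernel of the differential of the Euclidean
  normalisation `v ↦ v/‖v‖` at `w ≠ 0` is `ℝ w` (calculus lemma for the radial map).

These are the elementary convexity facts behind "radial projection from an interior point of a
compact convex body onto a sphere is a bijection" (Eberlein–O'Neill 1973, §1, convex sets in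
Hadamard manifolds; Lee 2018, Ch. 12). Everything is proved; no definitions, no named facts.

## References

* J. M. Lee, *Introduction to Riemannian Manifolds*, 2nd ed. (2018), Thm. 12.8, Prop. 10.32,
  Cor. 4.28, Lemma 5.18, Prop. 5.19. [LeeRiemannianManifolds2018]
* P. Eberlein, B. O'Neill, *Visibility manifolds*, Pacific J. Math. 46 (1973), §1.
  [EberleinOneill1973]
-/

noncomputable section

-- the registered namespace `Summit.SmoothPoincare4.SmoothPoincare4.Theorems` repeats a component
set_option linter.dupNamespace false

open Bundle Set Filter Function
open scoped Manifold ContDiff Topology Pointwise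

namespace Summit.SmoothPoincare4.SmoothPoincare4.Theorems

namespace HadamardConvexBoundary

open Literature.Geometry.Lorentzian Literature.Geometry.Riemannian
open Literature.Geometry.Lorentzian.PseudoRiemannianMetric
open HadamardConvex

section Hadamard

variable {E : Type*} [NormedAddCommGroup E] [NormedSpace ℝ E] {H : Type*} [TopologicalSpace H]
  {I : ModelWithCorners ℝ E H} {M : Type*} [TopologicalSpace M] [ChartedSpace H M]
  [IsManifold I ∞ M] [FiniteDimensional ℝ E] [CompleteSpace E] [T2Space M] [I.Boundaryless]
  {g : PseudoRiemannianMetric I ∞ E (TangentSpace I : M → Type _)} [g.HasLeviCivita]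
  [CovariantDerivative.ContMDiffCovariantDerivative g.leviCivita 1]
  [CovariantDerivative.ContMDiffCovariantDerivative g.leviCivita ∞]

/-! ### Reversal of geodesic segments -/

/-- **Reversal of a geodesic segment**: for `q = exp_p v` and `V = γ_v'(1) = d(exp_p)_v(v)`,
`exp_q(s · (−V)) = exp_p((1 − s) v)` for all `s` — the curve `s ↦ γ_v(1 − s)` is a geodesic
(affine reparametrisation, O'Neill 1983, Ch. 3, Lemma 3.21) with initial data `(q, −V)`, hence it
is `γ_{−V}` by uniqueness (Lee 2018, Cor. 4.28), and `γ_w(s) = exp(s w)` (Lemma 5.18).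
[cite: LeeRiemannianManifolds2018, Cor. 4.28 and Lemma 5.18] -/
theorem expMap_expMap_smul_neg (hc : IsGeodesicallyComplete g.leviCivita) (p : M)
    (v : TangentSpace I p) (s : ℝ) :
    expMap g.leviCivita (expMap g.leviCivita p v)
      (s • -(mfderiv 𝓘(ℝ, E) I (fun w : E ↦ expMap g.leviCivita p w) v v)) =
    expMap g.leviCivita p ((1 - s) • v) := by
  obtain ⟨-, hgeo, h0, hv0⟩ := maximalGeodesic_of_isGeodesicallyComplete hc p v
  set γ : ℝ → M := maximalGeodesic g.leviCivita p v with hγ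
  set V := mfderiv 𝓘(ℝ, E) I (fun w : E ↦ expMap g.leviCivita p w) v v with hV
  have hvel : velocity I γ 1 = V := by
    have h := velocity_maximalGeodesic_eq_mfderiv_expMap (I := I) hc p v 1
    rw [one_smul] at h
    exact h
  have hq : γ 1 = expMap g.leviCivita p v := (expMap_eq_maximalGeodesic hc p _).symm
  -- the reversed curve
  set δ : ℝ → M := fun s ↦ γ (-1 * s + 1) with hδ
  have hδgeo : IsGeodesic g.leviCivita δ := by
    have h := IsGeodesicOn.comp_affine_holds (cov := g.leviCivita) hgeo (-1) 1
    rwa [preimage_univ] at h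
  have hδ0 : δ 0 = expMap g.leviCivita p v := by
    show γ (-1 * 0 + 1) = _
    rw [mul_zero, zero_add]
    exact hq
  have hδv : velocity I δ 0 = (show TangentSpace I (expMap g.leviCivita p v) from -V) := by
    have h := velocity_comp_affine (I := I) γ (-1) 1 0
    rw [show (-1 : ℝ) * 0 + 1 = 1 by ring, hvel, neg_one_smul] at h
    exact h
  obtain ⟨-, heq⟩ := maximalGeodesic_unique (cov := g.leviCivita)
    (IsGeodesic.isMaximalGeodesicOn_univ (cov := g.leviCivita) hδgeo) (mem_univ _) hδ0 hδv
  have h1 : expMap g.leviCivita (expMap g.leviCivita p v)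
      (s • (show TangentSpace I (expMap g.leviCivita p v) from -V)) = δ s := by
    rw [heq (mem_univ s)]
    exact expMap_smul hc _ _ s
  have h2 : δ s = expMap g.leviCivita p ((1 - s) • v) := by
    show γ (-1 * s + 1) = _
    rw [show (-1 : ℝ) * s + 1 = 1 - s by ring]
    exact (expMap_smul hc p _ (1 - s)).symm
  exact h1.trans h2

/-- **The reversed segment ends at the starting point**: `exp_q(−γ_v'(1)) = p` for `q = exp_p v`.
[cite: LeeRiemannianManifolds2018, Cor. 4.28 and Lemma 5.18] -/
theorem expMap_expMap_neg (hc : IsGeodesicallyComplete g.leviCivita) (p : M)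
    (v : TangentSpace I p) :
    expMap g.leviCivita (expMap g.leviCivita p v)
      (-(mfderiv 𝓘(ℝ, E) I (fun w : E ↦ expMap g.leviCivita p w) v v)) = p := by
  have h := expMap_expMap_smul_neg (g := g) hc p v 1
  rw [one_smul, sub_self, zero_smul] at h
  rw [h]
  exact expMap_zero (cov := g.leviCivita) p


/-- **The reversed segment ends at the starting point, free form**: if `exp_p v = q` and
`d(exp_p)_v(v) = V` then `exp_q(−V) = p`. [cite: LeeRiemannianManifolds2018, Cor. 4.28 and Lemma 5.18] -/
theorem expMap_neg_of_eq (hc : IsGeodesicallyComplete g.leviCivita) (p : M)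
    (v : TangentSpace I p) {q : M} (hq : expMap g.leviCivita p v = q) {V : E}
    (hV : mfderiv 𝓘(ℝ, E) I (fun w : E ↦ expMap g.leviCivita p w) v v = V) :
    expMap g.leviCivita q (-(V : TangentSpace I q)) = p := by
  subst hq hV
  exact expMap_expMap_neg hc p v

/-- The ray `t ↦ exp_o(t u)` is continuous (the exponential map of a complete smooth connection
is smooth, Lee 2018, Prop. 5.19). [cite: LeeRiemannianManifolds2018, Prop. 5.19] -/
theorem continuous_expMap_smul (hc : IsGeodesicallyComplete g.leviCivita) (o : M)
    (u : TangentSpace I o) : Continuous fun t : ℝ ↦ expMap g.leviCivita o (t • u) := by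
  have h1 : Continuous fun t : ℝ ↦ t • (u : E) := continuous_id.smul continuous_const
  exact (contMDiff_expMap hc o).continuous.comp h1

section ConvexBody

variable [SimplyConnectedSpace M] [LocallyPathConnectedSpace M] {C : Set M}

/-! ### Exit points of rays from an interior point -/

/-- **Rays from an interior point of a compact convex body exit through the frontier**: for `C`
compact, `o ∈ interior C` and `u ≠ 0`, the number `T = sup {t ≥ 0 | exp_o(t u) ∈ C}` is positive
and `exp_o(T u) ∈ frontier C` (the set is closed, bounded since `d(o, exp_o(tu)) = t |u|` and `C`
is bounded, and contains a neighbourhood of `0`; beyond `T` the ray is outside `C`).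
[cite: EberleinOneill1973, §1] -/
theorem exists_exit (hg : g.IsRiemannian) (hc : IsGeodesicallyComplete g.leviCivita)
    (hsec : ∀ (x : M) (X Y : TangentSpace I x), g.curvatureForm g.leviCivita x X Y Y X ≤ 0)
    (hC : IsCompact C) {o : M} (ho : o ∈ interior C) {u : TangentSpace I o} (hu : u ≠ 0) :
    ∃ T : ℝ, 0 < T ∧ expMap g.leviCivita o (T • u) ∈ frontier C ∧
      ∀ t : ℝ, 0 ≤ t → expMap g.leviCivita o (t • u) ∈ C → t ≤ T := by
  set f : ℝ → M := fun t ↦ expMap g.leviCivita o (t • u) with hf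
  have hfc : Continuous f := continuous_expMap_smul hc o u
  set A : Set ℝ := Ici 0 ∩ f ⁻¹' C with hA
  have hAcl : IsClosed A := isClosed_Ici.inter (hC.isClosed.preimage hfc)
  have hoC : o ∈ C := interior_subset ho
  have hf0 : f 0 = o := by
    show expMap g.leviCivita o ((0 : ℝ) • u) = o
    rw [zero_smul]; exact expMap_zero (cov := g.leviCivita) o
  have h0A : (0 : ℝ) ∈ A := ⟨Set.self_mem_Ici, by show f 0 ∈ C; rw [hf0]; exact hoC⟩
  -- `d(o, f t) = t |u|`
  set c : ℝ := Real.sqrt (g.val o u u) with hc_def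
  have hcpos : 0 < c := Real.sqrt_pos.2 (hg o u hu)
  have hdist : ∀ t : ℝ, 0 ≤ t → g.edist hg o (f t) = ENNReal.ofReal (t * c) := by
    intro t ht
    show g.edist hg o (expMap g.leviCivita o (t • u)) = _
    rw [edist_expMap_eq hg hc hsec o (t • u)]
    congr 1
    simp only [map_smul, FunLike.coe_smul, Pi.smul_apply, smul_eq_mul]
    rw [show t * (t * g.val o u u) = t ^ 2 * g.val o u u by ring,
      Real.sqrt_mul (sq_nonneg t), Real.sqrt_sq ht]
  -- `A` is bounded: `C` is bounded in distance from `o`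
  haveI : LocallyCompactSpace M := Manifold.locallyCompact_of_finiteDimensional (M := M) I
  have hco : Continuous fun y : M ↦ g.edist hg o y :=
    (PseudoRiemannianMetric.continuous_edist hg).comp (Continuous.prodMk_right o)
  obtain ⟨y₀, -, hmax⟩ := hC.exists_isMaxOn ⟨o, hoC⟩ hco.continuousOn
  set R : ℝ := (g.edist hg o y₀).toReal with hR_def
  have hR : ∀ y ∈ C, g.edist hg o y ≤ ENNReal.ofReal R := fun y hy ↦ by
    rw [hR_def, ENNReal.ofReal_toReal (edist_ne_top hg o y₀)]
    exact hmax hy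
  have hbdd : BddAbove A := by
    refine ⟨R / c, fun t ht ↦ ?_⟩
    obtain ⟨ht0, htC⟩ := ht
    have h1 := hR (f t) htC
    rw [hdist t ht0, ENNReal.ofReal_le_ofReal_iff ENNReal.toReal_nonneg] at h1
    rw [le_div_iff₀ hcpos]
    exact h1
  set T : ℝ := sSup A with hT
  have hTA : T ∈ A := hAcl.csSup_mem ⟨0, h0A⟩ hbdd
  have hle : ∀ t ∈ A, t ≤ T := fun t ht ↦ le_csSup hbdd ht
  -- beyond an interior point the ray stays in `C` for a while
  have hpush : ∀ s : ℝ, f s ∈ interior C → ∃ ε : ℝ, 0 < ε ∧ ∀ t, |t - s| < ε → f t ∈ C := by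
    intro s hs
    have hnhds : f ⁻¹' interior C ∈ 𝓝 s :=
      hfc.continuousAt.preimage_mem_nhds (isOpen_interior.mem_nhds hs)
    obtain ⟨ε, hε, hball⟩ := Metric.mem_nhds_iff.1 hnhds
    refine ⟨ε, hε, fun t ht ↦ interior_subset (hball ?_)⟩
    rw [Metric.mem_ball, Real.dist_eq]
    exact ht
  -- `T > 0`
  have hTpos : 0 < T := by
    obtain ⟨ε, hε, hball⟩ := hpush 0 (by rw [hf0]; exact ho)
    have hε2 : 0 < ε / 2 := by positivity
    have hmem : ε / 2 ∈ A :=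
      ⟨Set.mem_Ici.2 hε2.le, hball _ (by rw [sub_zero, abs_of_pos hε2]; linarith)⟩
    exact lt_of_lt_of_le hε2 (hle _ hmem)
  -- `f T` is not an interior point
  have hnot : f T ∉ interior C := by
    intro hint
    obtain ⟨ε, hε, hball⟩ := hpush T hint
    have hmem : T + ε / 2 ∈ A :=
      ⟨by have := hTA.1; simp only [mem_Ici] at this ⊢; linarith,
        hball _ (by rw [add_sub_cancel_left, abs_of_pos (by positivity)]; linarith)⟩
    have := hle _ hmem
    linarith
  refine ⟨T, hTpos, ⟨subset_closure hTA.2, hnot⟩, fun t ht htC ↦ hle t ⟨ht, htC⟩⟩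

/-- **Between an interior point and a frontier point of its ray there are only interior points**:
if `o ∈ interior C`, `exp_o w ∈ frontier C` (in particular `∈ C`, `C` closed) and `0 < c < 1`,
then `exp_o(c w) ∈ interior C` — reverse the segment (`expMap_expMap_smul_neg`: it is the
segment from `q = exp_o w ∈ C` to the interior point `o`) and apply `expMap_smul_mem_interior`.
Consequently a ray from `o` meets `frontier C` at most once. [cite: EberleinOneill1973, §1] -/
theorem expMap_smul_mem_interior_of_mem_frontier (hg : g.IsRiemannian)
    (hc : IsGeodesicallyComplete g.leviCivita)
    (hsec : ∀ (x : M) (X Y : TangentSpace I x), g.curvatureForm g.leviCivita x X Y Y X ≤ 0)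
    (hconv : ∀ p ∈ C, ∀ q ∈ C, ∀ m : M,
      g.edist hg p m + g.edist hg m q = g.edist hg p q → m ∈ C)
    (hCcl : IsClosed C) {o : M} (ho : o ∈ interior C) {w : TangentSpace I o}
    (hw : expMap g.leviCivita o w ∈ frontier C) {c : ℝ} (hc0 : 0 < c) (hc1 : c < 1) :
    expMap g.leviCivita o (c • w) ∈ interior C := by
  have hq : expMap g.leviCivita o w ∈ C := hCcl.frontier_subset hw
  have hrev := expMap_expMap_smul_neg (g := g) hc o w (1 - c)
  rw [sub_sub_cancel] at hrev
  rw [← hrev]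
  refine expMap_smul_mem_interior hg hc hsec hconv hq ?_ (by linarith) (by linarith)
  rw [expMap_expMap_neg (g := g) hc o w]
  exact ho

/-! ### The cone over the interior, seen from a point of `C` -/

/-- **The open cone over `exp_p⁻¹(interior C)` is mapped into `interior C`.** For `p ∈ C` and the
diffeomorphism `Φ = exp_p`: if `Φ k ∈ interior C` and `0 < t < 1` then `Φ (t k) ∈ interior C` —
indeed the union over `t ∈ (0,1)` of the dilates `t · Φ⁻¹(interior C)` is an open subset of
`Φ⁻¹(C)` (`expMap_smul_mem`), hence of `Φ⁻¹(interior C)`. (This is the special case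
`expMap_smul_mem_interior` with `t < 1`; stated for the transversality argument of the route item.)
[cite: EberleinOneill1973, §1] -/
theorem apply_smul_mem_interior (hg : g.IsRiemannian) (hc : IsGeodesicallyComplete g.leviCivita)
    (hsec : ∀ (x : M) (X Y : TangentSpace I x), g.curvatureForm g.leviCivita x X Y Y X ≤ 0)
    (hconv : ∀ p ∈ C, ∀ q ∈ C, ∀ m : M,
      g.edist hg p m + g.edist hg m q = g.edist hg p q → m ∈ C)
    {p : M} (hp : p ∈ C) (Φ : E ≃ₘ^∞⟮𝓘(ℝ, E), I⟯ M)
    (hΦ : ∀ v : E, Φ v = expMap g.leviCivita p v) {k : E} (hk : Φ k ∈ interior C) {t : ℝ}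
    (ht : t ∈ Ioc (0 : ℝ) 1) : Φ (t • k) ∈ interior C := by
  rw [hΦ]
  exact expMap_smul_mem_interior hg hc hsec hconv hp (w := k) (by rw [← hΦ]; exact hk) ht.1 ht.2

end ConvexBody

end Hadamard

/-! ### The kernel of the differential of the Euclidean normalisation (used by the radial map) -/

section Normalize

variable {F : Type*} [NormedAddCommGroup F] [InnerProductSpace ℝ F]

/-- The Euclidean normalisation `v ↦ v/‖v‖` is differentiable away from `0`. [folklore] -/
theorem differentiableAt_normalize {w : F} (hw : w ≠ 0) :
    DifferentiableAt ℝ (fun v : F ↦ ‖v‖⁻¹ • v) w :=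
  (((contDiffAt_norm ℝ hw (n := 1)).inv (norm_ne_zero_iff.2 hw)).differentiableAt one_ne_zero).smul
    differentiableAt_id

/-- **Kernel of the differential of `v ↦ v/‖v‖`**: at `w ≠ 0`, a vector `η` with
`d(v ↦ v/‖v‖)_w(η) = 0` is a multiple of `w` (product rule: the differential is
`η ↦ ‖w‖⁻¹ η + (d(‖·‖⁻¹)_w η) w`). [folklore] -/
theorem exists_eq_smul_of_fderiv_normalize_eq_zero {w η : F} (hw : w ≠ 0)
    (h : fderiv ℝ (fun v : F ↦ ‖v‖⁻¹ • v) w η = 0) : ∃ μ : ℝ, η = μ • w := by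
  have h1 : DifferentiableAt ℝ (fun v : F ↦ ‖v‖⁻¹) w :=
    ((contDiffAt_norm ℝ hw (n := 1)).inv (norm_ne_zero_iff.2 hw)).differentiableAt one_ne_zero
  set c' : F →L[ℝ] ℝ := fderiv ℝ (fun v : F ↦ ‖v‖⁻¹) w with hc'
  have h2 : HasFDerivAt (fun v : F ↦ ‖v‖⁻¹ • v)
      (‖w‖⁻¹ • ContinuousLinearMap.id ℝ F + c'.smulRight w) w :=
    h1.hasFDerivAt.smul (hasFDerivAt_id w)
  rw [h2.fderiv] at h
  have h3 : ‖w‖⁻¹ • η + c' η • w = 0 := by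
    simpa only [add_apply, smul_apply, ContinuousLinearMap.id_apply,
      ContinuousLinearMap.smulRight_apply] using h
  have hn : ‖w‖ ≠ 0 := norm_ne_zero_iff.2 hw
  refine ⟨-(‖w‖ * c' η), ?_⟩
  calc η = ‖w‖ • (‖w‖⁻¹ • η) := by rw [smul_smul, mul_inv_cancel₀ hn, one_smul]
    _ = ‖w‖ • (-(c' η • w)) := by rw [eq_neg_of_add_eq_zero_left h3]
    _ = -(‖w‖ * c' η) • w := by rw [smul_neg, smul_smul, neg_smul]

end Normalize

end HadamardConvexBoundary

end Summit.SmoothPoincare4.SmoothPoincare4.Theorems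

end
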